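import Summits.QuantumAdvantage.QuantumAdvantage.Theorems.RandomOracleGaugeDecoupledCoreAAL1FamilyPoincare
import Literature.Computability.QuantumComplexity.InfluenceBounds
import HarnessLib

/-!
# Crux `PseudoBoundedAA` (stmt-QuantumAdvantage-15237) / `AAConj` (10748) — the SPECTRAL-NORM CORNER:
# `maxInf ≥ 4·Var²/‖p̂‖₁²`, so the Aaronson–Ambainis conjecture holds for polynomials of polynomial spectral norm

For ANY real polynomial `p` on the cube with Fourier spectral norm `‖p̂‖₁ = Σ_S |p̂(S)| ≤ L`:
`Var[p] = Σ_{S≠∅} p̂(S)² ≤ L · max_{S≠∅} |p̂(S)|`, so some nonempty `S` has `|p̂(S)| ≥ Var/L`, and every `i ∈ S` has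
`Inf_i[p] = 4 Σ_{T∋i} p̂(T)² ≥ 4 p̂(S)² ≥ 4 Var²/L²` — no degree and no boundedness hypothesis.  Hence the conjecture's
conclusion `C(ε/d)^c ≤ Inf_i` holds whenever `‖p̂‖₁ ≤ K d^κ` (`(c, C) = (2κ+2, 4/K²)`).  Together with the Boolean /
near-Boolean corner (`…L1FamilyBooleanCorner`, `…L1FamilyNearBoolean`) and the symmetric corner (`…SymmetricCorner`)
this is the third polynomial-rate corner in kernel; the address family (spectral norm `2^m`) and Chebyshev profiles lie
outside it, as they must.

* `exists_fourier_coeff_ge` — `∃ S ≠ ∅, Var/L ≤ |p̂(S)|`;  `exists_influence_ge_of_spectralNorm` — `∃ i, 4Var²/L² ≤ Inf_i`;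
* `aaConj_spectralCorner` — the statement of the route decl `AAConj` with the extra hypothesis `‖p̂‖₁ ≤ K d^κ`.

Honest label: an elementary corner (three lines of Fourier analysis); no stub, crux or summit is closed.
Sources: O'Donnell 2014 §1.4, §3.1 (spectral norm); Aaronson–Ambainis arXiv:0911.0996 Conj. 6.
-/

-- D-0017: single-conjunct summit ⇒ the duplicate `QuantumAdvantage.QuantumAdvantage` is mandated.
set_option linter.dupNamespace false

noncomputable section

open Finset
open Literature.Computability.QuantumComplexity
open Literature.Computability.Complexity.LowDegree (cubeFourierCoeff sum_cubeFourierCoeff_sq)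
open Summit.QuantumAdvantage.QuantumAdvantage.Cruxes.DecoupledCoreAA.L1Family.Poincare (boolVariance_eq_sq_sub)

namespace Summit.QuantumAdvantage.QuantumAdvantage.Theorems.SosSandwich.SpectralCorner

variable {N : ℕ}

/-- `Var[p] = Σ_{S ≠ ∅} p̂(S)²`, spelled as the full Parseval sum minus the empty coefficient.
[cite: ODonnell2014, §1.4] -/
theorem boolVariance_eq_sum_sq_sub_empty (p : MvPolynomial (Fin N) ℝ) :
    boolVariance p = ∑ S, cubeFourierCoeff (evalBool p) S ^ 2 - cubeFourierCoeff (evalBool p) ∅ ^ 2 := by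
  rw [boolVariance_eq_sq_sub, sum_cubeFourierCoeff_sq, ← boolAvg_evalBool_eq_fourier_empty]
  rfl

/-- **A heavy nonempty Fourier coefficient**: if `Σ_S |p̂(S)| ≤ L` and `Var[p] > 0` then some `S ≠ ∅` has
`|p̂(S)| ≥ Var[p]/L` (`Var = Σ_{S≠∅} p̂(S)² ≤ max_{S≠∅}|p̂(S)| · L`). [cite: ODonnell2014, §3.1] -/
theorem exists_fourier_coeff_ge (p : MvPolynomial (Fin N) ℝ) {L : ℝ}
    (hL : ∑ S, |cubeFourierCoeff (evalBool p) S| ≤ L) (hv : 0 < boolVariance p) :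
    ∃ S : Finset (Fin N), S ≠ ∅ ∧ boolVariance p / L ≤ |cubeFourierCoeff (evalBool p) S| := by
  classical
  -- the variance is the Fourier weight on the NONEMPTY sets
  have hsing : (Finset.univ.filter fun S : Finset (Fin N) => ¬ S ≠ ∅) = {∅} := by
    ext S; simp
  have hsplit : boolVariance p =
      ∑ S ∈ Finset.univ.filter (fun S : Finset (Fin N) => S ≠ ∅), cubeFourierCoeff (evalBool p) S ^ 2 := by
    rw [boolVariance_eq_sum_sq_sub_empty,
      ← Finset.sum_filter_add_sum_filter_not Finset.univ (fun S : Finset (Fin N) => S ≠ ∅)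
        (fun S => cubeFourierCoeff (evalBool p) S ^ 2), hsing, Finset.sum_singleton]
    ring
  have hFne : (Finset.univ.filter (fun S : Finset (Fin N) => S ≠ ∅)).Nonempty := by
    by_contra h
    rw [Finset.not_nonempty_iff_eq_empty] at h
    rw [hsplit, h, Finset.sum_empty] at hv
    exact lt_irrefl _ hv
  obtain ⟨S₀, hS₀, hmax⟩ := Finset.exists_max_image _ (fun S => |cubeFourierCoeff (evalBool p) S|) hFne
  have hS₀ne : S₀ ≠ ∅ := (Finset.mem_filter.mp hS₀).2
  refine ⟨S₀, hS₀ne, ?_⟩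
  -- `Var ≤ |p̂(S₀)| · Σ_{S ≠ ∅} |p̂(S)| ≤ |p̂(S₀)| · L`
  have hVle : boolVariance p ≤ |cubeFourierCoeff (evalBool p) S₀| * L := by
    calc boolVariance p
        = ∑ S ∈ Finset.univ.filter (fun S : Finset (Fin N) => S ≠ ∅), cubeFourierCoeff (evalBool p) S ^ 2 := hsplit
      _ = ∑ S ∈ Finset.univ.filter (fun S : Finset (Fin N) => S ≠ ∅),
            |cubeFourierCoeff (evalBool p) S| * |cubeFourierCoeff (evalBool p) S| :=
          Finset.sum_congr rfl fun S _ => by rw [← sq_abs, sq]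
      _ ≤ ∑ S ∈ Finset.univ.filter (fun S : Finset (Fin N) => S ≠ ∅),
            |cubeFourierCoeff (evalBool p) S₀| * |cubeFourierCoeff (evalBool p) S| :=
          Finset.sum_le_sum fun S hS => mul_le_mul_of_nonneg_right (hmax S hS) (abs_nonneg _)
      _ = |cubeFourierCoeff (evalBool p) S₀| *
            ∑ S ∈ Finset.univ.filter (fun S : Finset (Fin N) => S ≠ ∅), |cubeFourierCoeff (evalBool p) S| := by
          rw [Finset.mul_sum]
      _ ≤ |cubeFourierCoeff (evalBool p) S₀| * ∑ S, |cubeFourierCoeff (evalBool p) S| :=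
          mul_le_mul_of_nonneg_left (Finset.sum_le_sum_of_subset_of_nonneg (Finset.filter_subset _ _)
            fun S _ _ => abs_nonneg _) (abs_nonneg _)
      _ ≤ |cubeFourierCoeff (evalBool p) S₀| * L := mul_le_mul_of_nonneg_left hL (abs_nonneg _)
  have hL0 : 0 < L := by
    by_contra hle
    push Not at hle
    have : |cubeFourierCoeff (evalBool p) S₀| * L ≤ 0 := mul_nonpos_of_nonneg_of_nonpos (abs_nonneg _) hle
    linarith
  rw [div_le_iff₀ hL0]
  exact hVle

/-- **Spectral-norm corner of Aaronson–Ambainis**: `Σ_S |p̂(S)| ≤ L` and `Var[p] > 0` give a variable with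
`Inf_i[p] ≥ 4·Var[p]²/L²` (any `i` in a heavy nonempty `S`: `Inf_i = 4Σ_{T∋i} p̂(T)² ≥ 4p̂(S)²`).  No degree, no
boundedness. [cite: ODonnell2014, §2.2 (Fourier formula for influences)] [cite: ODonnell2014, §3.1] -/
theorem exists_influence_ge_of_spectralNorm (p : MvPolynomial (Fin N) ℝ) {L : ℝ}
    (hL : ∑ S, |cubeFourierCoeff (evalBool p) S| ≤ L) (hv : 0 < boolVariance p) :
    ∃ i : Fin N, 4 * boolVariance p ^ 2 / L ^ 2 ≤ influence i p := by
  classical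
  obtain ⟨S, hSne, hS⟩ := exists_fourier_coeff_ge p hL hv
  obtain ⟨i, hi⟩ := Finset.nonempty_iff_ne_empty.mpr hSne
  refine ⟨i, ?_⟩
  have hL0 : 0 < L := by
    by_contra hle
    push Not at hle
    have h1 : boolVariance p / L ≤ 0 := div_nonpos_of_nonneg_of_nonpos hv.le hle
    -- then `|p̂(S)| ≥ Var/L` says nothing; but `Var/L ≤ 0 < Var` — we still need `L > 0`: from `hS` and `hv`?
    -- Use instead: `Σ_S |p̂ S| ≥ |p̂ S| ≥ Var/L`; if `L ≤ 0` then `Σ |p̂| ≤ 0` forces all coefficients `0`, so `Var = 0`.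
    have hall : ∀ T, cubeFourierCoeff (evalBool p) T = 0 := by
      intro T
      have hsum0 : ∑ U, |cubeFourierCoeff (evalBool p) U| ≤ 0 := hL.trans hle
      have hnn : ∀ U ∈ (Finset.univ : Finset (Finset (Fin N))), 0 ≤ |cubeFourierCoeff (evalBool p) U| :=
        fun U _ => abs_nonneg _
      have := (Finset.sum_eq_zero_iff_of_nonneg hnn).mp (le_antisymm hsum0 (Finset.sum_nonneg hnn)) T
        (Finset.mem_univ _)
      exact abs_eq_zero.mp this
    have hV0 : boolVariance p = 0 := by
      rw [boolVariance_eq_sum_sq_sub_empty]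
      simp [hall]
    linarith
  rw [influence_eq_sum_sq_fourier]
  have hmem : S ∈ (Finset.univ : Finset (Finset (Fin N))).filter (fun T => i ∈ T) :=
    Finset.mem_filter.mpr ⟨Finset.mem_univ _, hi⟩
  have hge : cubeFourierCoeff (evalBool p) S ^ 2 ≤ ∑ T with i ∈ T, cubeFourierCoeff (evalBool p) T ^ 2 :=
    Finset.single_le_sum (fun T _ => sq_nonneg (cubeFourierCoeff (evalBool p) T)) hmem
  have hsq : (boolVariance p / L) ^ 2 ≤ cubeFourierCoeff (evalBool p) S ^ 2 := by
    calc (boolVariance p / L) ^ 2 ≤ |cubeFourierCoeff (evalBool p) S| ^ 2 :=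
          pow_le_pow_left₀ (div_nonneg hv.le hL0.le) hS 2
      _ = cubeFourierCoeff (evalBool p) S ^ 2 := sq_abs _
  rw [show 4 * boolVariance p ^ 2 / L ^ 2 = 4 * (boolVariance p / L) ^ 2 by rw [div_pow]; ring]
  linarith

/-- **The statement of the route decl `AAConj` on the spectral-norm corner** (`(c, C) = (2κ + 2, 4/K²)`): for all
`N`, `d ≥ 1`, every `[0,1]`-bounded `p` (any degree) with `Σ_S |p̂(S)| ≤ K d^κ`, and every `0 < ε ≤ Var[p]`, some
variable has `(4/K²)(ε/d)^{2κ+2} ≤ Inf_i[p]`. [cite: AaronsonAmbainis2014, Conj. 6] [cite: ODonnell2014, §3.1] -/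
theorem aaConj_spectralCorner (K : ℝ) (hK : 0 < K) (κ : ℕ) (N d : ℕ) (p : MvPolynomial (Fin N) ℝ) (ε : ℝ)
    (hspec : ∑ S, |cubeFourierCoeff (evalBool p) S| ≤ K * (d : ℝ) ^ κ) (hd : 1 ≤ d)
    (hb : ∀ x, 0 ≤ evalBool p x ∧ evalBool p x ≤ 1) (hε : 0 < ε) (hεV : ε ≤ boolVariance p) :
    ∃ i : Fin N, 4 / K ^ 2 * (ε / d) ^ (2 * κ + 2) ≤ influence i p := by
  have hv : 0 < boolVariance p := lt_of_lt_of_le hε hεV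
  obtain ⟨i, hi⟩ := exists_influence_ge_of_spectralNorm p hspec hv
  refine ⟨i, ?_⟩
  have hd1 : (1 : ℝ) ≤ (d : ℝ) := by exact_mod_cast hd
  have hd0 : (0 : ℝ) < (d : ℝ) := by positivity
  -- `Var ≤ 1/4 ≤ 1`
  have hV1 : boolVariance p ≤ 1 := by
    have hq : boolVariance p ≤ boolAvg (fun x => (evalBool p x - 1 / 2) ^ 2) := by
      rw [boolVariance_eq_sq_sub]
      unfold boolAvg
      rw [← sub_nonneg]
      have h2N : (0 : ℝ) < (2 : ℝ) ^ N := by positivity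
      have e : (∑ x, (evalBool p x - 1 / 2) ^ 2) / (2 : ℝ) ^ N -
          ((∑ x, evalBool p x ^ 2) / (2 : ℝ) ^ N - ((∑ x, evalBool p x) / (2 : ℝ) ^ N) ^ 2) =
          ((∑ x, evalBool p x) / (2 : ℝ) ^ N - 1 / 2) ^ 2 := by
        have hc : ∑ x : Fin N → Bool, (evalBool p x - 1 / 2) ^ 2 =
            ∑ x, evalBool p x ^ 2 - ∑ x : Fin N → Bool, evalBool p x + (2 : ℝ) ^ N / 4 := by
          have : ∀ x : Fin N → Bool, (evalBool p x - 1 / 2) ^ 2 = evalBool p x ^ 2 - evalBool p x + 1 / 4 := by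
            intro x; ring
          simp_rw [this]
          rw [Finset.sum_add_distrib, Finset.sum_sub_distrib, Finset.sum_const, Finset.card_univ,
            Fintype.card_fun, Fintype.card_bool, Fintype.card_fin, nsmul_eq_mul]
          push_cast; ring
        rw [hc]
        field_simp
        ring
      rw [e]
      exact sq_nonneg _
    have hle : boolAvg (fun x => (evalBool p x - 1 / 2) ^ 2) ≤ 1 / 4 := by
      have hpt : ∀ x, (evalBool p x - 1 / 2) ^ 2 ≤ 1 / 4 := by
        intro x; have := hb x; nlinarith [this.1, this.2]
      calc boolAvg (fun x => (evalBool p x - 1 / 2) ^ 2) ≤ boolAvg (fun _ : Fin N → Bool => (1 / 4 : ℝ)) := by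
            unfold boolAvg
            exact div_le_div_of_nonneg_right (Finset.sum_le_sum fun x _ => hpt x) (by positivity)
        _ = 1 / 4 := boolAvg_const _
    linarith
  have hε1 : ε ≤ 1 := hεV.trans hV1
  -- `(4/K²)(ε/d)^{2κ+2} ≤ 4 ε²/(K² d^{2κ}) ≤ 4 Var²/(K d^κ)²`
  have hpow : (ε / d) ^ (2 * κ + 2) ≤ ε ^ 2 / (d : ℝ) ^ (2 * κ) := by
    rw [div_pow, pow_add, pow_add]
    have hεk : ε ^ (2 * κ) ≤ 1 := pow_le_one₀ hε.le hε1
    have hdk : (1 : ℝ) ≤ (d : ℝ) ^ 2 := one_le_pow₀ hd1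
    have hd2k : (0 : ℝ) < (d : ℝ) ^ (2 * κ) := by positivity
    rw [div_le_div_iff₀ (by positivity) hd2k]
    calc ε ^ (2 * κ) * ε ^ 2 * (d : ℝ) ^ (2 * κ) ≤ 1 * ε ^ 2 * (d : ℝ) ^ (2 * κ) := by gcongr
      _ = ε ^ 2 * ((d : ℝ) ^ (2 * κ) * 1) := by ring
      _ ≤ ε ^ 2 * ((d : ℝ) ^ (2 * κ) * (d : ℝ) ^ 2) := by gcongr
  have e2 : K ^ 2 * (d : ℝ) ^ (2 * κ) = (K * (d : ℝ) ^ κ) ^ 2 := by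
    rw [mul_pow, ← pow_mul, Nat.mul_comm κ 2]
  rw [← e2] at hi
  refine le_trans ?_ hi
  have hden : (0 : ℝ) < K ^ 2 * (d : ℝ) ^ (2 * κ) := by positivity
  calc 4 / K ^ 2 * (ε / d) ^ (2 * κ + 2) ≤ 4 / K ^ 2 * (ε ^ 2 / (d : ℝ) ^ (2 * κ)) :=
        mul_le_mul_of_nonneg_left hpow (by positivity)
    _ = 4 * ε ^ 2 / (K ^ 2 * (d : ℝ) ^ (2 * κ)) := by rw [div_mul_div_comm]
    _ ≤ 4 * boolVariance p ^ 2 / (K ^ 2 * (d : ℝ) ^ (2 * κ)) := by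
        apply div_le_div_of_nonneg_right _ hden.le
        nlinarith [pow_le_pow_left₀ hε.le hεV 2]

end Summit.QuantumAdvantage.QuantumAdvantage.Theorems.SosSandwich.SpectralCorner

end
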